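import Summits.RiemannHypothesis.RiemannHypothesis.Theorems.WeilFormatCDataRungGenericA
import Summits.RiemannHypothesis.RiemannHypothesis.Theorems.WeilFormatCDataKitG
import Literature.NumberTheory.LFunctions.YoshidaWindowGramFrontDoorA
import Literature.NumberTheory.LFunctions.YoshidaWindowGramColumnData
import HarnessLib

/-!
# Format C: the COLUMN-BAND kernel front door — `WeilPositivityOn a` from certified column data (kit `CB`)

Helper file of the rh-explicit Weil-positivity programme (`--supports stmt-RiemannHypothesis-0098`; seat
rh-explicit-weil-2 gen6; cell memo `run/shared/lean/pub/rh-explicit/rh-explicit-weil-2/COLBAND-U1.md`), RH-free, no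
definitions, no named facts.  It composes weil-1's parametrised door `WeilFormatC.weilPositivityOn_of_formatC_kernelsA`
(far diagonals with a CERTIFIED prime constant `A`, hypothesis `hPA`) with the column-band evaluator of Literature part IX
(`YoshidaWindowGramColumnData.lean`): per sector

* the coupling columns `M^σ(i, B+t)`, `t < K = B₃ − B`, are CERTIFIED PACKED DATA (`Encl.DataNear`, assembled from
  `checkRect` chunks by `colDataNear_extendRows`), with per-row weighted digit sums (`Encl.RowDots`);
* the column weights are reciprocal dyadic `w(B+t) = 2^{cv}/v_t` (`Encl.wvF`), certified per column against the far
  diagonal boxes (`checkWeightsEvenV` / `checkWeightsOddV`, read under `Encl.FDValidA` — part X);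
* the tail matrix `U₂` of the door is ANY real function with its majorant premise (`hU2E`/`hU2O`, e.g.
  `U2EvenJ_majorant`) AND a factorisation `U₂(i,j) = Σ_{r<R} φ(i,r)ψ(j,r) + [i=j]·dg(i)` whose factors are certified
  packed data (`hφ`, `hψ`, `RowDots`) and whose diagonal is boxed (`hdg`);
* the Schur matrix `M − U₁ − U₂` is enclosed row band by row band (`Encl.SchurNearG` of `usubCB`, from
  `checkSchurBandG` via `SchurNearG.extend_of_check` + `mem_subBoxCB`) and certified PSD by `PsdDyadic.checkPsdMid`
  (assembled from bands by `FormatCPsd.checkPsdMid_of_bands` in the generated files).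

* `schurNearG_of_lower` — lower-triangle Schur bands suffice (tail symmetric, midpoints symmetric by `checkPsdMid`);
* `weilPositivityOn_of_kitCB` — the kit.
-/

set_option linter.dupNamespace false
set_option autoImplicit false

noncomputable section

open Complex Finset Matrix
open scoped Real BigOperators ComplexConjugate ArithmeticFunction.vonMangoldt

namespace Summit.RiemannHypothesis.RiemannHypothesis.Theorems.WeilFormatC

open Literature.NumberTheory.LFunctions Literature.NumberTheory.LFunctions.Yoshida1992
  Literature.NumberTheory.LFunctions.Yoshida1992.Encl Literature.Analysis.SpecialFunctions
  Literature.Analysis.ValidatedNumerics.NumericsMP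

variable {a : ℝ} {S : ℕ} {ks : List PrimeLen} {C : Consts} {F : FDConsts}

/-- The door's EVEN Schur entry (inline form) is `schurEntryG` of the even sector kernel and `usubCB`, given the tail
factorisation. -/
theorem even_entry_eq_schurEntryG (a : ℝ) (Be Ke cv : ℕ) (v : List ℕ) (U₂ φ ψ : ℕ → ℕ → ℝ) (dg : ℕ → ℝ) (R2 : ℕ)
    (hfac : ∀ i < Be, ∀ j < Be, U₂ i j = (∑ r ∈ Finset.range R2, φ i r * ψ j r) + (if i = j then dg i else 0))
    (i j : Fin Be) :
    ((if (i : ℕ) = 0 then gramCoeff a 0 j else if (j : ℕ) = 0 then gramCoeff a i 0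
        else (gramCoeff a i j + gramCoeff a i (-(j : ℤ))) / 2)
      - (∑ m ∈ Finset.Ico Be (Be + Ke), (if (i : ℕ) = 0 then gramCoeff a 0 m else if m = 0 then gramCoeff a i 0
          else (gramCoeff a i m + gramCoeff a i (-(m : ℤ))) / 2) *
          (if (j : ℕ) = 0 then gramCoeff a 0 m else if m = 0 then gramCoeff a j 0
          else (gramCoeff a j m + gramCoeff a j (-(m : ℤ))) / 2) / (wvF v cv Be m))
      - U₂ i j)
    = schurEntryG (sectorKernel false (gramCoeff a))
        (usubCB (sectorKernel false (gramCoeff a)) φ ψ dg Be Ke cv v R2) i j := by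
  unfold schurEntryG usubCB
  rw [hfac i i.isLt j j.isLt, sum_replicate_one_eq]
  simp only [sectorKernel, evenKernel, Bool.false_eq_true, if_false]
  have hcol : ∑ m ∈ Finset.Ico Be (Be + Ke), (if (i : ℕ) = 0 then gramCoeff a 0 m else if m = 0 then gramCoeff a i 0
          else (gramCoeff a i m + gramCoeff a i (-(m : ℤ))) / 2) *
          (if (j : ℕ) = 0 then gramCoeff a 0 m else if m = 0 then gramCoeff a j 0
          else (gramCoeff a j m + gramCoeff a j (-(m : ℤ))) / 2) / (wvF v cv Be m)
      = ∑ t ∈ Finset.range Ke, (if (i : ℕ) = 0 then gramCoeff a 0 (Be + t) else if Be + t = 0 then gramCoeff a i 0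
          else (gramCoeff a i (Be + t) + gramCoeff a i (-((Be + t : ℕ) : ℤ))) / 2) *
          (if (j : ℕ) = 0 then gramCoeff a 0 (Be + t) else if Be + t = 0 then gramCoeff a j 0
          else (gramCoeff a j (Be + t) + gramCoeff a j (-((Be + t : ℕ) : ℤ))) / 2) * ((v.getD t 0 : ℝ) / 2 ^ cv) := by
    rw [Finset.sum_Ico_eq_sum_range, Nat.add_sub_cancel_left]
    refine Finset.sum_congr rfl fun t _ ↦ ?_
    rw [div_eq_mul_one_div, one_div_wvF]
    push_cast
    ring_nf
  rw [hcol]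
  push_cast
  ring

/-- The door's ODD Schur entry (inline form) is `schurEntryG` of the odd sector kernel and `usubCB`. -/
theorem odd_entry_eq_schurEntryG (a : ℝ) (Bo Ko cv : ℕ) (v : List ℕ) (U₂ φ ψ : ℕ → ℕ → ℝ) (dg : ℕ → ℝ) (R2 : ℕ)
    (hfac : ∀ k < Bo, ∀ k' < Bo, U₂ k k' = (∑ r ∈ Finset.range R2, φ k r * ψ k' r) + (if k = k' then dg k else 0))
    (k k' : Fin Bo) :
    ((((gramCoeff a (((k : ℕ) : ℤ) + 1) (((k' : ℕ) : ℤ) + 1) - gramCoeff a (((k : ℕ) : ℤ) + 1) (-(((k' : ℕ) : ℤ) + 1))) / 2)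
      - (∑ l ∈ Finset.Ico Bo (Bo + Ko), ((gramCoeff a (((k : ℕ) : ℤ) + 1) ((l : ℤ) + 1) - gramCoeff a (((k : ℕ) : ℤ) + 1) (-((l : ℤ) + 1))) / 2) *
          ((gramCoeff a (((k' : ℕ) : ℤ) + 1) ((l : ℤ) + 1) - gramCoeff a (((k' : ℕ) : ℤ) + 1) (-((l : ℤ) + 1))) / 2) /
            (wvF v cv Bo l))
      - U₂ k k'))
    = schurEntryG (sectorKernel true (gramCoeff a))
        (usubCB (sectorKernel true (gramCoeff a)) φ ψ dg Bo Ko cv v R2) k k' := by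
  unfold schurEntryG usubCB
  rw [hfac k k.isLt k' k'.isLt, sum_replicate_one_eq]
  simp only [sectorKernel, oddKernel, if_true]
  have hcol : ∑ l ∈ Finset.Ico Bo (Bo + Ko), ((gramCoeff a (((k : ℕ) : ℤ) + 1) ((l : ℤ) + 1) - gramCoeff a (((k : ℕ) : ℤ) + 1) (-((l : ℤ) + 1))) / 2) *
          ((gramCoeff a (((k' : ℕ) : ℤ) + 1) ((l : ℤ) + 1) - gramCoeff a (((k' : ℕ) : ℤ) + 1) (-((l : ℤ) + 1))) / 2) /
            (wvF v cv Bo l)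
      = ∑ t ∈ Finset.range Ko, ((gramCoeff a (((k : ℕ) : ℤ) + 1) (((Bo + t : ℕ) : ℤ) + 1) - gramCoeff a (((k : ℕ) : ℤ) + 1) (-(((Bo + t : ℕ) : ℤ) + 1))) / 2) *
          ((gramCoeff a (((k' : ℕ) : ℤ) + 1) (((Bo + t : ℕ) : ℤ) + 1) - gramCoeff a (((k' : ℕ) : ℤ) + 1) (-(((Bo + t : ℕ) : ℤ) + 1))) / 2) * ((v.getD t 0 : ℝ) / 2 ^ cv) := by
    rw [Finset.sum_Ico_eq_sum_range, Nat.add_sub_cancel_left]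
    refine Finset.sum_congr rfl fun t _ ↦ ?_
    rw [div_eq_mul_one_div, one_div_wvF]
  rw [hcol]
  ring

/-- `∀ k < n, P k` from `PsdDyadic.allBelowN` (re-proved: the library's copy is private). -/
theorem of_allBelowN' {n : ℕ} {P : ℕ → Bool} (h : PsdDyadic.allBelowN n P = true) {k : ℕ} (hk : k < n) :
    P k = true := by
  induction n with
  | zero => exact absurd hk (Nat.not_lt_zero _)
  | succ n ih =>
    have h' : (PsdDyadic.allBelowN n P && P n) = true := h
    rw [Bool.and_eq_true] at h'
    rcases Nat.lt_succ_iff_lt_or_eq.1 hk with hk' | rfl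
    · exact ih h'.1 hk'
    · exact h'.2

/-- The midpoints of a successful `checkPsdMid` are symmetric on `n × n`. -/
theorem getMZ_symm_of_checkPsdMid {n : ℕ} {δ ρ : ℤ} {mid L : List (List ℤ)}
    (h : PsdDyadic.checkPsdMid n δ ρ mid L = true) :
    ∀ i < n, ∀ j < n, PsdDyadic.getMZ mid i j = PsdDyadic.getMZ mid j i := by
  unfold PsdDyadic.checkPsdMid at h
  simp only [Bool.and_eq_true] at h
  obtain ⟨⟨-, hsy⟩, -⟩ := h
  unfold PsdDyadic.symmCheck at hsy
  intro i hi j hj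
  rcases lt_trichotomy j i with hji | rfl | hij
  · have h1 := of_allBelowN' hsy hi
    have h2 := of_allBelowN' h1 hji
    simpa using h2
  · rfl
  · have h1 := of_allBelowN' hsy hj
    have h2 := of_allBelowN' h1 hij
    have h3 : PsdDyadic.getMZ mid j i = PsdDyadic.getMZ mid i j := by simpa using h2
    exact h3.symm

/-- `usubCB` is symmetric on `B × B` when the tail it factors is symmetric. -/
theorem usubCB_comm (M U₂ φ ψ : ℕ → ℕ → ℝ) (dg : ℕ → ℝ) (B K cv R2 : ℕ) (v : List ℕ)
    (hfac : ∀ i < B, ∀ j < B, U₂ i j = (∑ r ∈ Finset.range R2, φ i r * ψ j r) + (if i = j then dg i else 0))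
    (hU : ∀ i j, U₂ i j = U₂ j i) {i j : ℕ} (hi : i < B) (hj : j < B) :
    usubCB M φ ψ dg B K cv v R2 i j = usubCB M φ ψ dg B K cv v R2 j i := by
  by_cases hij : i = j
  · subst hij; rfl
  unfold usubCB
  rw [sum_replicate_one_eq, sum_replicate_one_eq, if_neg hij, if_neg (Ne.symm hij)]
  have h1 := hfac i hi j hj
  have h2 := hfac j hj i hi
  rw [if_neg hij] at h1
  rw [if_neg (Ne.symm hij)] at h2
  have hs : ∑ r ∈ Finset.range R2, φ i r * ψ j r = ∑ r ∈ Finset.range R2, φ j r * ψ i r := by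
    rw [← add_zero (∑ r ∈ Finset.range R2, φ i r * ψ j r), ← h1, hU i j, h2, add_zero]
  have hc : ∑ t ∈ Finset.range K, M i (B + t) * M j (B + t) * ((v.getD t 0 : ℝ) / 2 ^ cv)
      = ∑ t ∈ Finset.range K, M j (B + t) * M i (B + t) * ((v.getD t 0 : ℝ) / 2 ^ cv) :=
    Finset.sum_congr rfl fun t _ ↦ by ring
  rw [hs, hc]

/-- **Lower-triangle Schur bands suffice**: a `SchurNearG … true B` result (rows checked for `j ≤ i` only) is a full one
when the tail is symmetric and the midpoints passed `checkPsdMid` (which checks their symmetry). -/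
theorem schurNearG_of_lower (a : ℝ) (odd : Bool) {U₂ φ ψ : ℕ → ℕ → ℝ} {dg : ℕ → ℝ} {B K cv R2 c : ℕ} {v : List ℕ}
    {ρS δ ρ : ℤ} {DS L : List (List ℤ)}
    (h : SchurNearG (sectorKernel odd (gramCoeff a)) (usubCB (sectorKernel odd (gramCoeff a)) φ ψ dg B K cv v R2)
      B c ρS DS true B)
    (hfac : ∀ i < B, ∀ j < B, U₂ i j = (∑ r ∈ Finset.range R2, φ i r * ψ j r) + (if i = j then dg i else 0))
    (hU : ∀ i j, U₂ i j = U₂ j i) (hP : PsdDyadic.checkPsdMid B δ ρ DS L = true) :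
    SchurNearG (sectorKernel odd (gramCoeff a)) (usubCB (sectorKernel odd (gramCoeff a)) φ ψ dg B K cv v R2)
      B c ρS DS false B :=
  h.of_lower (sectorKernel_gramCoeff_comm odd a) (fun _ hi _ hj ↦ usubCB_comm _ U₂ φ ψ dg B K cv R2 v hfac hU hi hj)
    (getMZ_symm_of_checkPsdMid hP)

/-- **`WeilPositivityOn a` from the COLUMN-BAND data kit with a CERTIFIED prime constant `A`.**  See the module docstring.
All hypotheses except `hPA`, the tail majorant premises `hU2E`/`hU2O` and the tail factorisations `hface`/`hfaco` are
delivered by `decide +kernel` certificates of the generated rung files or are integer comparisons. -/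
theorem weilPositivityOn_of_kitCB (ha : 0 < a)
    {A : ℝ} (hPA : ∀ (s : Finset ℤ) (c : ℤ → ℂ),
      -(A * ∑ n ∈ s, ‖c n‖ ^ 2) ≤ ∑ n ∈ s, ∑ m ∈ s, (conj (c n) * c m).re * primeCoeff a n m)
    (hS : 0 < S) (hC : ConstsValid S a ks C) (hF : FDValidA S a A F) {tab : List IdxRec}
    -- ===== EVEN sector =====
    {Be Ke B3e : ℕ} (hBe : 2 ≤ Be) (hKe : Be + Ke = B3e) (hTe : TabValid S a ks (Be + 1) tab) {ctabE : List IdxRec}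
    (hCTe : TabColValid S a ks Be (B3e + 1) ctabE)
    -- far diagonal: positivity at `Be`, tail base `d₀ = d0ze·2^{−cde} ≤ d̂⁺_A(B3e)`
    {cde d0ze pe qe : ℕ} (hd0ze : 0 < d0ze) (hsqe : checkSqrtUpper 8 (Be - 1) pe qe = true)
    (h0e : 0 < (devEvenBox S C F (tget tab Be) Be pe qe).lo)
    (hd0e : (d0ze : ℤ) * (S : ℤ) ≤ (devEvenBox S C F (tget ctabE B3e) B3e pe qe).lo * 2 ^ cde)
    -- reciprocal column weights
    {cve : ℕ} {ve : List ℕ} (hWe : checkWeightsEvenV S C F ctabE Be Ke cve ve pe qe = true)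
    -- tail: majorant premise + factorisation (the factors' data enter only through `hSe`)
    (U2E : ℕ → ℕ → ℝ)
    (hU2E : ∀ d : ℕ → ℝ, (∀ m, B3e ≤ m → (d0ze : ℝ) * (1 / 2 ^ cde) ≤ d m) → ∀ (N : ℕ) (x : Fin Be → ℝ),
      ∑ m ∈ Finset.Ico B3e N, (∑ i : Fin Be, (if (i : ℕ) = 0 then gramCoeff a 0 m else if m = 0 then gramCoeff a i 0
        else (gramCoeff a i m + gramCoeff a i (-(m : ℤ))) / 2) * x i) ^ 2 / d m
        ≤ x ⬝ᵥ (Matrix.of fun i j : Fin Be ↦ U2E i j) *ᵥ x)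
    {R2e : ℕ} (φe ψe : ℕ → ℕ → ℝ) (dge : ℕ → ℝ)
    (hface : ∀ i < Be, ∀ j < Be, U2E i j = (∑ r ∈ Finset.range R2e, φe i r * ψe j r) + (if i = j then dge i else 0))
    -- Schur rows (all of them: `SchurNearG … false Be`, assembled from `checkSchurBandG` bands by
    -- `SchurNearG.extend_of_check` + `mem_subBoxCB` over the certified column / factor data) and the PSD verdict
    {ce : ℕ} {ρe δe : ℤ} {DSe Le : List (List ℤ)}
    (hSe : SchurNearG (sectorKernel false (gramCoeff a))
      (usubCB (sectorKernel false (gramCoeff a)) φe ψe dge Be Ke cve ve R2e) Be ce ρe DSe false Be)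
    (hPe : PsdDyadic.checkPsdMid Be δe ρe DSe Le = true)
    -- ===== ODD sector =====
    {Bo Ko B3o : ℕ} (hBo : 1 ≤ Bo) (hKo : Bo + Ko = B3o) {ctabO : List IdxRec}
    (hCTo : TabColValid S a ks Bo (B3o + 2) ctabO)
    {cdo d0zo po qo Ksero qr : ℕ} {rso : List ℕ} (hd0zo : 0 < d0zo) (hsqo : checkSqrtUpper 8 Bo po qo = true)
    (h0o : 0 < (devOddBox S C F (tget ctabO (Bo + 1)) Bo Bo po qo).lo)
    (hd0o : (d0zo : ℤ) * (S : ℤ) ≤ (devOddBox S C F (tget ctabO (B3o + 1)) B3o Bo po qo).lo * 2 ^ cdo)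
    {cvo : ℕ} {vo : List ℕ} (hWo : checkWeightsOddV S Ksero C F ctabO Bo Ko cvo vo rso qr po qo = true)
    (U2O : ℕ → ℕ → ℝ)
    (hU2O : ∀ d : ℕ → ℝ, (∀ l, B3o ≤ l → (d0zo : ℝ) * (1 / 2 ^ cdo) ≤ d l) → ∀ (N : ℕ) (x : Fin Bo → ℝ),
      ∑ l ∈ Finset.Ico B3o N, (∑ k : Fin Bo, ((gramCoeff a (((k : ℕ) : ℤ) + 1) ((l : ℤ) + 1)
        - gramCoeff a (((k : ℕ) : ℤ) + 1) (-((l : ℤ) + 1))) / 2) * x k) ^ 2 / d l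
        ≤ x ⬝ᵥ (Matrix.of fun k k' : Fin Bo ↦ U2O k k') *ᵥ x)
    {R2o : ℕ} (φo ψo : ℕ → ℕ → ℝ) (dgo : ℕ → ℝ)
    (hfaco : ∀ k < Bo, ∀ k' < Bo, U2O k k' = (∑ r ∈ Finset.range R2o, φo k r * ψo k' r) + (if k = k' then dgo k else 0))
    {co : ℕ} {ρo δo : ℤ} {DSo Lo : List (List ℤ)}
    (hSo : SchurNearG (sectorKernel true (gramCoeff a))
      (usubCB (sectorKernel true (gramCoeff a)) φo ψo dgo Bo Ko cvo vo R2o) Bo co ρo DSo false Bo)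
    (hPo : PsdDyadic.checkPsdMid Bo δo ρo DSo Lo = true) :
    WeilPositivityOn a := by
  subst hKe hKo
  have hSr : (0 : ℝ) < S := by exact_mod_cast hS
  -- ===== EVEN numeric facts =====
  have hBe1 : 1 ≤ Be := by omega
  have hreBe : MI.mem S (reDigammaQuarter (freq a Be)) (tget tab Be).reP := (hTe Be (by omega)).2.reP
  have hreB3e : MI.mem S (reDigammaQuarter (freq a (Be + Ke))) (tget ctabE (Be + Ke)).reP :=
    (hCTe (Be + Ke) (by omega) (by omega)).2
  have hloBe := devEvenBox_lo_le_A hS ha hC hF hreBe (by omega) hsqe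
  have hloB3e := devEvenBox_lo_le_A hS ha hC hF hreB3e (by omega) hsqe
  have h0e' : 0 < devEvenA a A Be Be := by
    have : (0 : ℝ) < (devEvenBox S C F (tget tab Be) Be pe qe).lo := by exact_mod_cast h0e
    nlinarith
  have hd0e' : (d0ze : ℝ) * (1 / 2 ^ cde) ≤ devEvenA a A Be (Be + Ke) := dyadic_le_of_lo hS hd0e hloB3e
  have hd0pos : (0 : ℝ) < (d0ze : ℝ) * (1 / 2 ^ cde) := by positivity
  -- even weights: `0 < 2^cv/v_t ≤ d̂⁺_A(Be + t)`
  have hwe : ∀ m, Be ≤ m → m < Be + Ke → 0 < wvF ve cve Be m ∧ wvF ve cve Be m ≤ devEvenA a A Be m := by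
    intro m hm hmK
    obtain ⟨hvpos, hvle⟩ := weightsEvenV_of_check hWe (m - Be) (by omega)
    rw [show Be + (m - Be) = m by omega] at hvle
    have hre : MI.mem S (reDigammaQuarter (freq a m)) (tget ctabE m).reP := (hCTe m hm (by omega)).2
    have hlo := devEvenBox_lo_le_A hS ha hC hF hre (by omega) hsqe (Be := Be) (p := pe) (q := qe)
    have := wv_le_of_lo hS hvpos hvle hlo
    simpa only [wvF] using this
  -- ===== ODD numeric facts =====
  have hreBo : MI.mem S (reDigammaQuarter (freq a ((Bo : ℤ) + 1))) (tget ctabO (Bo + 1)).reP := by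
    have h := (hCTo (Bo + 1) (by omega) (by omega)).2
    push_cast at h; exact h
  have hreB3o : MI.mem S (reDigammaQuarter (freq a (((Bo + Ko : ℕ) : ℤ) + 1))) (tget ctabO (Bo + Ko + 1)).reP := by
    have h := (hCTo (Bo + Ko + 1) (by omega) (by omega)).2
    push_cast at h ⊢; exact h
  have hloBo := devOddBox_lo_le_A hS ha hC hF hreBo (by omega) hsqo
  have hloB3o := devOddBox_lo_le_A hS ha hC hF hreB3o (by omega) hsqo
  have h0o' : 0 < devOdd0A a A Bo Bo := by
    have : (0 : ℝ) < (devOddBox S C F (tget ctabO (Bo + 1)) Bo Bo po qo).lo := by exact_mod_cast h0o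
    nlinarith
  have hd0o' : (d0zo : ℝ) * (1 / 2 ^ cdo) ≤ devOdd0A a A Bo (Bo + Ko) := dyadic_le_of_lo hS hd0o hloB3o
  have hd0opos : (0 : ℝ) < (d0zo : ℝ) * (1 / 2 ^ cdo) := by positivity
  -- odd weights: `0 < 2^cv/v_t ≤ d̂⁻_atan,A(Bo + t)`
  have hwo : ∀ l, Bo ≤ l → l < Bo + Ko → 0 < wvF vo cvo Bo l ∧ wvF vo cvo Bo l ≤ devOddAA a A Bo l := by
    intro l hl hlK
    obtain ⟨hvpos, hsq, Y, hY, hvle⟩ := weightsOddV_of_check hWo (l - Bo) (by omega)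
    rw [show Bo + (l - Bo) = l by omega] at hsq hY
    have hre : MI.mem S (reDigammaQuarter (freq a ((l : ℤ) + 1))) (tget ctabO (l + 1)).reP := by
      have h := (hCTo (l + 1) (by omega) (by omega)).2
      push_cast at h; exact h
    have hlo := devOddABox_lo_le_A hS ha hC hF hre (by omega) hsq hsqo hY
    have := wv_le_of_lo hS hvpos hvle hlo
    simpa only [wvF] using this
  -- ===== the door =====
  refine weilPositivityOn_of_formatC_kernelsA ha hPA hBe (Nat.le_add_right Be Ke) (d0e := (d0ze : ℝ) * (1 / 2 ^ cde))
    (wvF ve cve Be) ?_ ?_ ?_ (Matrix.of fun i j : Fin Be ↦ U2E i j) hU2E ?_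
    hBo (Nat.le_add_right Bo Ko) (d0o := (d0zo : ℝ) * (1 / 2 ^ cdo)) (wvF vo cvo Bo) ?_ ?_ ?_
    (Matrix.of fun k k' : Fin Bo ↦ U2O k k') hU2O ?_
  · -- h0e
    have h := h0e'; unfold devEvenA at h; exact h
  · -- hd0e
    refine ⟨hd0pos, ?_⟩
    have h := hd0e'; unfold devEvenA at h; exact_mod_cast h
  · -- hwe
    intro m hm hmK
    have h := hwe m hm hmK
    unfold devEvenA at h; exact h
  · -- hSe
    intro x
    have hP := PsdDyadic.psd_of_checkPsdMid hPe (u := 1 / 2 ^ ce) (by positivity)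
      (fun i j : Fin Be ↦ schurEntryG (sectorKernel false (gramCoeff a))
        (usubCB (sectorKernel false (gramCoeff a)) φe ψe dge Be Ke cve ve R2e) i j)
      (fun i j ↦ hSe i i.isLt i.isLt j j.isLt (fun h ↦ absurd h (by decide))) x
    refine le_of_le_of_eq hP (Finset.sum_congr rfl fun i _ ↦ Finset.sum_congr rfl fun j _ ↦ ?_)
    rw [← even_entry_eq_schurEntryG a Be Ke cve ve U2E φe ψe dge R2e hface i j, Matrix.of_apply]
  · -- h0o
    have h := h0o'; unfold devOdd0A at h; exact h
  · -- hd0o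
    refine ⟨hd0opos, ?_⟩
    have h := hd0o'; unfold devOdd0A at h; exact_mod_cast h
  · -- hwo
    intro l hl hlK
    have h := hwo l hl hlK
    unfold devOddAA at h; exact h
  · -- hSo
    intro x
    have hP := PsdDyadic.psd_of_checkPsdMid hPo (u := 1 / 2 ^ co) (by positivity)
      (fun k k' : Fin Bo ↦ schurEntryG (sectorKernel true (gramCoeff a))
        (usubCB (sectorKernel true (gramCoeff a)) φo ψo dgo Bo Ko cvo vo R2o) k k')
      (fun k k' ↦ hSo k k.isLt k.isLt k' k'.isLt (fun h ↦ absurd h (by decide))) x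
    refine le_of_le_of_eq hP (Finset.sum_congr rfl fun k _ ↦ Finset.sum_congr rfl fun k' _ ↦ ?_)
    rw [← odd_entry_eq_schurEntryG a Bo Ko cvo vo U2O φo ψo dgo R2o hfaco k k', Matrix.of_apply]

end Summit.RiemannHypothesis.RiemannHypothesis.Theorems.WeilFormatC

end
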